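import Summits.ABC.ABC.Theses.DefiniteXi
import Literature.NumberTheory.Automorphic.BCDTModularity
import Literature.NumberTheory.EllipticCurves.ModularParametrizationProofs
import Literature.NumberTheory.EllipticCurves.ModularParametrizationDegreeProofs
import Literature.NumberTheory.EllipticCurves.UniformizationUniqueProofs
import Literature.NumberTheory.EllipticCurves.SzpiroFreyConductorProofs
import Literature.NumberTheory.EllipticCurves.Szpiro
import HarnessLib

/-!
# Route DefiniteXi, item `FreyModularity` (stmt-ABC-11340): the item on the CDT 1999 trust base

`FreyModularity` (every Frey curve `E_(a,b) = freyCurve a b`, `a, b` coprime, `ab(a+b) ≠ 0`,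
carries a `ModularParametrizationData` at its conductor level) is the Modularity Theorem for Frey
curves in datum form.  `DefiniteXiFreyModularity.lean` derives it from the tree's fact
`nonempty_modularParametrizationData` (= BCDT 2001 Thm. A in the form (6)), equivalently from
`exists_isNewformOf` (Thm. A, all elliptic curves over `ℚ`) and
`IsNewformOf.exists_maninConstant_ne_zero`.  This file records that the *modularity* input the item
needs is strictly weaker than Theorem A: the conductor of a Frey curve divides `2⁸ · rad(ab(a+b))`
(`conductorNorm_freyCurve_dvd_holds`, a theorem of the tree), so it is never divisible by `27`
(indeed not by `9`), and **Conrad–Diamond–Taylor 1999, Thm. 7.1.2** ("every elliptic curve over `ℚ`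
whose conductor is not divisible by `27` is modular"; tree fact `BCDT.CDT_theorem_7_1_2`) already
gives the newform of every Frey curve.

* `nonempty_modularParametrizationData_of_isNewformOf` — per curve and level: newform + Néron-type
  pair + nonzero integral multiplier ⟹ a datum (uniformisation and modular degree are theorems of
  the tree: `IsNeronLatticeOf.exists_uniformize_holds`, `exists_modularDegree_holds`).
* `not_nine_dvd_conductorNorm_freyCurve` — `9 ∤ N_{E_(a,b)}` (so `27 ∤ N_{E_(a,b)}`).
* `isModular_freyCurve_of_CDT_theorem_7_1_2` — CDT Thm. 7.1.2 ⟹ every Frey curve is modular.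
* `freyModularity_of_CDT_theorem_7_1_2` — CDT Thm. 7.1.2 and the commensurability of `Λ_f` and
  `Λ_E` (`IsNewformOf.exists_maninConstant_ne_zero`) ⟹ `FreyModularity`, the Néron-type pair
  coming from `exists_isNeronLatticeOf_holds`.
* `freyModularity_iff_isNewformOf_and_commensurable` — the exact residual: the item is the
  conjunction of the two open facts (modularity; commensurability of `Λ_f` and `Λ_E`) specialised
  to Frey curves, both universally quantified.

The imports avoid the Heegner-point files: only the parametrisation leaves
(`ModularParametrizationProofs`, `ModularParametrizationDegreeProofs`), the uniqueness half of the
Uniformization Theorem (`UniformizationUniqueProofs`), the Frey conductor bound and `BCDTModularity`.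

## References

* B. Conrad, F. Diamond, R. Taylor, *Modularity of certain potentially Barsotti–Tate Galois
  representations*, J. Amer. Math. Soc. 12 (1999), 521–567: Thm. 7.1.2 (p. 551).
* C. Breuil, B. Conrad, F. Diamond, R. Taylor, *On the modularity of elliptic curves over `ℚ`:
  wild 3-adic exercises*, J. Amer. Math. Soc. 14 (2001), 843–939: Thm. A, p. 845 (2), (6).
* E. Bombieri, W. Gubler, *Heights in Diophantine Geometry*, CUP 2006: Ex. 12.5.10 (conductor of
  the Frey curve).
* J. H. Silverman, *The Arithmetic of Elliptic Curves*, 2nd ed., GTM 106 (2009): Prop. VI.3.6,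
  Thm. VI.5.1.
-/

-- `Summit.<Summit>.<Problem>` is the mandated summit-side namespace (CONVENTIONS §2); for the
-- single-conjunct summit `ABC` the two coincide, so the duplicate `ABC.ABC` is deliberate.
set_option linter.dupNamespace false

noncomputable section

open scoped MatrixGroups ModularForm

open CongruenceSubgroup UpperHalfPlane
open Literature.NumberTheory.EllipticCurves
open Literature.NumberTheory.EllipticCurves.ModularForms
open Literature.NumberTheory.Automorphic

namespace Summit.ABC.ABC.Theorems

/-- **A parametrisation datum from a newform, a Néron-type pair and a nonzero multiplier** (per
curve `W/ℚ` and level `N`; BCDT 2001, "(2) ⇒ (6)" of p. 845 with the analytic halves supplied): if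
`f ∈ S₂(Γ₀(N))` is the newform of the elliptic curve `W` (`IsNewformOf W f`), `L` a period pair with
`g₂(L) = c₄/12`, `g₃(L) = c₆/216` (`IsNeronLatticeOf`) and `c ≠ 0` an integer with `c Λ_f ⊆ Λ_L`, then
`Nonempty (ModularParametrizationData W N)`: the uniformisation `ℂ →+ E(ℂ)` with kernel `Λ_L` is
`IsNeronLatticeOf.exists_uniformize_holds` (Silverman AEC VI.3.6(b)), the degree of
`Γ₀(N)τ ↦ c · 2πi∫_{i∞}^τ f (mod Λ_L)` is `exists_modularDegree_holds`, transported to `E(ℂ)` along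
`ℂ/Λ_L ≃ E(ℂ)` (`finite_setOf_card_fiberOrbits_ne_iff`).  Same statement and proof as the tree's
`ModularParametrizationData.nonempty_of_isNewformOf` (`HeegnerPointsModularityProofs.lean`), restated
here to keep this file off the Heegner-point import chain.
[cite: BCDTJAMS2001, Thm. A with (6) of p. 845] -/
theorem nonempty_modularParametrizationData_of_isNewformOf {W : WeierstrassCurve ℚ} [W.IsElliptic]
    {N : ℕ} [NeZero N] {f : CuspForm (Gamma0 N) 2} (hf : IsNewformOf W f) {L : PeriodPair}
    (hL : IsNeronLatticeOf (W.baseChange ℂ) L) {c : ℤ} (hc0 : c ≠ 0)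
    (hc : ∀ z ∈ periodLattice f, (c : ℂ) * z ∈ L.lattice) :
    Nonempty (ModularParametrizationData W N) := by
  -- adapted from Literature/NumberTheory/EllipticCurves/HeegnerPointsModularityProofs.lean
  haveI : (W.baseChange ℂ).IsElliptic := by rw [WeierstrassCurve.baseChange]; infer_instance
  obtain ⟨u, hker, hsurj, hspec⟩ := IsNeronLatticeOf.exists_uniformize_holds hL
  obtain ⟨d, hd, hfin⟩ := exists_modularDegree_holds hf.1.ne_zero (L := L) (c := (c : ℂ))
    (Int.cast_ne_zero.mpr hc0) hc
  -- transport the exceptional set along `ℂ/Λ_L ≃ E(ℂ)`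
  have hker' : L.lattice.toAddSubgroup = u.ker :=
    SetLike.coe_injective (by rw [Submodule.coe_toAddSubgroup, hker])
  let e : ℂ ⧸ L.lattice.toAddSubgroup ≃+ (W.baseChange ℂ).toAffine.Point :=
    QuotientAddGroup.liftEquiv L.lattice.toAddSubgroup hsurj hker'
  have he : ∀ x : ℂ, e.toEquiv (x : ℂ ⧸ L.lattice.toAddSubgroup) = u x := fun _ ↦ rfl
  have key := (finite_setOf_card_fiberOrbits_ne_iff e.toEquiv
    (fun τ : ℍ ↦ (((c : ℂ) * eichlerIntegral f τ : ℂ) : ℂ ⧸ L.lattice.toAddSubgroup)) d).mpr hfin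
  simp only [he] at key
  exact ⟨{ f := f
           isNewformOf := hf
           L := L
           isNeronLattice := hL
           uniformize := u
           ker_uniformize := hker
           uniformize_surjective := hsurj
           uniformize_spec := hspec
           c := c
           smul_periodLattice_le := hc
           deg := d
           deg_pos := hd
           deg_spec := key }⟩

/-- **The conductor of a Frey curve is not divisible by `9`.**  For coprime `a, b` with
`ab(a+b) ≠ 0`, `N_{E_(a,b)} ∣ 2⁸ · rad(ab(a+b))` (`conductorNorm_freyCurve_dvd_holds`; Bombieri–Gubler
Ex. 12.5.10: the Frey curve is semistable at every odd prime), and the radical is squarefree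
(Mathlib `UniqueFactorizationMonoid.squarefree_radical`), so `9 = 3 · 3` cannot divide `N`.
[cite: BombieriGubler2006, Ex. 12.5.10] -/
theorem not_nine_dvd_conductorNorm_freyCurve {a b : ℤ} (hab : IsCoprime a b)
    (h0 : a * b * (a + b) ≠ 0) : ¬ 9 ∣ (freyCurve a b).conductorNorm ℤ := by
  intro h9
  have hdvd := conductorNorm_freyCurve_dvd_holds a b hab h0
  -- `9 ∣ 2⁸ · r` with `r = rad(ab(a+b))` squarefree
  have h9' : 9 ∣ 2 ^ 8 * (UniqueFactorizationMonoid.radical (a * b * (a + b))).natAbs :=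
    h9.trans hdvd
  have hcop : Nat.Coprime 9 (2 ^ 8) := by norm_num
  have h9r : 9 ∣ (UniqueFactorizationMonoid.radical (a * b * (a + b))).natAbs :=
    hcop.dvd_of_dvd_mul_left h9'
  have hsq : Squarefree (UniqueFactorizationMonoid.radical (a * b * (a + b))).natAbs :=
    Int.squarefree_natAbs.mpr UniqueFactorizationMonoid.squarefree_radical
  have h3 : IsUnit (3 : ℕ) := hsq 3 ((show (3 : ℕ) * 3 = 9 by norm_num) ▸ h9r)
  exact absurd (Nat.isUnit_iff.mp h3) (by norm_num)

/-- **CDT 1999, Thm. 7.1.2 makes every Frey curve modular.**  If every elliptic curve over `ℚ` of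
conductor not divisible by `27` is modular (`BCDT.CDT_theorem_7_1_2`, Conrad–Diamond–Taylor 1999,
Thm. 7.1.2, in the tree's form: a newform `f ∈ S₂(Γ₀(N_E))` with `aₙ(f) = aₙ(E)`), then every Frey
curve `E_(a,b)` (`a, b` coprime, `ab(a+b) ≠ 0`; elliptic by `isElliptic_freyCurve`) is modular,
since `27 ∤ N_{E_(a,b)}` (`not_nine_dvd_conductorNorm_freyCurve`).
[cite: ConradDiamondTaylor1999, Thm. 7.1.2] -/
theorem isModular_freyCurve_of_CDT_theorem_7_1_2 (h712 : BCDT.CDT_theorem_7_1_2) {a b : ℤ}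
    (hab : IsCoprime a b) (h0 : a * b * (a + b) ≠ 0)
    [NeZero ((freyCurve a b).conductorNorm ℤ)] : BCDT.IsModular (freyCurve a b) := by
  haveI := isElliptic_freyCurve h0
  exact h712 (freyCurve a b) fun h27 ↦
    not_nine_dvd_conductorNorm_freyCurve hab h0 ((show (9 : ℕ) ∣ 27 by norm_num).trans h27)

/-- **`FreyModularity` on the Conrad–Diamond–Taylor trust base.**  CDT 1999, Thm. 7.1.2
(`BCDT.CDT_theorem_7_1_2`: conductor not divisible by `27` ⟹ modular — applicable to every Frey
curve by `not_nine_dvd_conductorNorm_freyCurve`) together with the commensurability of the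
Eichler–Shimura lattice `Λ_f` and the Néron-type lattice `Λ_E`
(`IsNewformOf.exists_maninConstant_ne_zero`: Eichler–Shimura with Faltings' isogeny theorem) give
`FreyModularity`: the newform comes from Thm. 7.1.2 at level `N = N_{E_(a,b)}`, a Néron-type period
pair of the Frey model from `exists_isNeronLatticeOf_holds` (Silverman AEC VI.5.1), the integer
`c ≠ 0` with `c Λ_f ⊆ Λ_E` from the commensurability fact, and the datum from
`nonempty_modularParametrizationData_of_isNewformOf`.  This replaces BCDT Thm. A (all curves; the
wild `3`-adic cases) by CDT Thm. 7.1.2 in the trust base of item stmt-ABC-11340 recorded in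
`freyModularity_of_exists_isNewformOf` (`DefiniteXiFreyModularity.lean`).
[cite: ConradDiamondTaylor1999, Thm. 7.1.2] [cite: BCDTJAMS2001, p. 845, (2) ⇒ (6)] -/
theorem freyModularity_of_CDT_theorem_7_1_2 (h712 : BCDT.CDT_theorem_7_1_2)
    (ha : IsNewformOf.exists_maninConstant_ne_zero) :
    Summit.ABC.ABC.Theses.DefiniteXi.FreyModularity := by
  intro a b hab h0 N _ hN
  haveI := isElliptic_freyCurve h0
  subst hN
  obtain ⟨f, hf⟩ := isModular_freyCurve_of_CDT_theorem_7_1_2 h712 hab h0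
  haveI : ((freyCurve a b).baseChange ℂ).IsElliptic := by
    rw [WeierstrassCurve.baseChange]; infer_instance
  obtain ⟨L, hL⟩ := exists_isNeronLatticeOf_holds ((freyCurve a b).baseChange ℂ)
  obtain ⟨c, hc0, hc⟩ := ha hf hL
  exact nonempty_modularParametrizationData_of_isNewformOf hf hL hc0 hc

/-- **The item is exactly "Frey curves are modular" ∧ "`Λ_f` and `Λ_E` are commensurable for Frey
curves".**  `FreyModularity` holds iff for all coprime `a, b` with `ab(a+b) ≠ 0` and `N = N_{E_(a,b)}`:
(i) some `f ∈ S₂(Γ₀(N))` is the newform of the Frey model (`IsNewformOf`; this is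
`BCDT.IsModular (freyCurve a b)`, supplied by CDT Thm. 7.1.2 / BCDT Thm. A), and (ii) for *every*
such `f` and *every* Néron-type period pair `L` of the Frey model there is an integer `c ≠ 0` with
`c Λ_f ⊆ Λ_L` (the named fact `IsNewformOf.exists_maninConstant_ne_zero` restricted to Frey curves).
`→`: the datum's own `f, L, c` (`c ≠ 0` by `ModularParametrizationData.exists_maninConstant_ne_zero`,
Edixhoven 1991 §1), moved to any other `f', L'` by uniqueness of the newform (`IsNewformOf.unique`,
`q`-expansion principle) and of the lattice with given invariants
(`PeriodPair.uniformization_unique_holds`, AEC VI.5.1); `←`: a Néron-type pair exists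
(`exists_isNeronLatticeOf_holds`) and the datum is
`nonempty_modularParametrizationData_of_isNewformOf`.  Compared with
`freyModularity_iff_forall_exists_isNewformOf` (`DefiniteXiFreyModularityResidual.lean`) the two
halves are separated and universally quantified, i.e. they are literally the two open Literature
facts specialised to Frey curves. [cite: BCDTJAMS2001, p. 845, (2) and (6)] -/
theorem freyModularity_iff_isNewformOf_and_commensurable :
    Summit.ABC.ABC.Theses.DefiniteXi.FreyModularity ↔
      ∀ a b : ℤ, IsCoprime a b → a * b * (a + b) ≠ 0 → ∀ (N : ℕ) [NeZero N],
        (freyCurve a b).conductorNorm ℤ = N →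
          (∃ f : CuspForm (Gamma0 N) 2, IsNewformOf (freyCurve a b) f) ∧
            ∀ f : CuspForm (Gamma0 N) 2, IsNewformOf (freyCurve a b) f → ∀ L : PeriodPair,
              IsNeronLatticeOf ((freyCurve a b).baseChange ℂ) L →
                ∃ c : ℤ, c ≠ 0 ∧ ∀ z ∈ periodLattice f, (c : ℂ) * z ∈ L.lattice := by
  unfold Summit.ABC.ABC.Theses.DefiniteXi.FreyModularity
  refine forall₂_congr fun a b ↦ forall_congr' fun _ ↦ forall_congr' fun h0 ↦
    forall₂_congr fun N _ ↦ forall_congr' fun _ ↦ ?_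
  haveI := isElliptic_freyCurve h0
  haveI : ((freyCurve a b).baseChange ℂ).IsElliptic := by
    rw [WeierstrassCurve.baseChange]; infer_instance
  constructor
  · rintro ⟨D⟩
    obtain ⟨c, hc0, hc⟩ := D.exists_maninConstant_ne_zero
    refine ⟨⟨D.f, D.isNewformOf⟩, fun f' hf' L' hL' ↦ ⟨c, hc0, fun z hz ↦ ?_⟩⟩
    rw [hf'.unique D.isNewformOf] at hz
    rw [← PeriodPair.uniformization_unique_holds D.L L' (D.isNeronLattice.1.trans hL'.1.symm)
      (D.isNeronLattice.2.trans hL'.2.symm)]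
    exact hc z hz
  · rintro ⟨⟨f, hf⟩, hcomm⟩
    obtain ⟨L, hL⟩ := exists_isNeronLatticeOf_holds ((freyCurve a b).baseChange ℂ)
    exact nonempty_modularParametrizationData_of_isNewformOf hf hL (hcomm f hf L hL).choose_spec.1
      (hcomm f hf L hL).choose_spec.2

end Summit.ABC.ABC.Theorems

end
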